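import Mathlib.Analysis.Calculus.MeanValue
import Literature.Analysis.FluidPDE.HarmonicMeanValue
import HarnessLib

/-!
# The mean value property of harmonic functions — local weighted form

Analysis/FluidPDE support file (everything PROVED) on the discharge path of the named fact
`Literature.Analysis.FluidPDE.sereginWang_liouville_L3_annulus` (Seregin–Wang 2020, Thm 1.1 (i);
the harmonic part of the pressure on an annulus is controlled through the mean value
property on small balls).  The tree's `HarmonicMeanValue.lean` proves the weighted mean value
property `∫ w(x) η(x₀ + x) dx = (∫ w) η(x₀)` for `η` harmonic on ALL of `E`
(`integral_radial_mul_harmonic`); here the same statement is proved under the LOCAL hypothesis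
of Gilbarg–Trudinger, Thm 2.1: `η ∈ C²(E)` with `Δη = 0` only on the ball `B(x₀, ρ)` carrying
the (radial, continuous) weight `w`, `supp w ⊆ B̄(0, ρ)`:

* `exists_radial_primitive_of_ball` — the radial primitive `∇P = w(y) y` of
  `HarmonicMeanValue.exists_radial_primitive`, with the support information `P = 0` off
  `B(0, ρ)` made explicit;
* `integral_radial_mul_fderiv_apply_self_eq_zero_of_ball` — the core identity
  `∫ w(y) Dη(y)[y] dy = 0` when `Δη = 0` on `B(0, ρ) ⊇ supp w` (Green's first identity without
  boundary terms, `Fluid.integral_inner_laplacian_add_eq_zero`, the product `P Δη` vanishing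
  identically);
* `integral_radial_mul_eq_of_laplacian_eq_zero` — **the local weighted mean value property**:
  `∫ w(x) η(x₀ + x) dx = (∫ w) η(x₀)` (the one-parameter family `J(s) = ∫ w(y) η(x₀ + s y) dy`
  has `J' = 0` on `[0, 1]`, by rescaling to the core identity for `0 < s ≤ 1` and by oddness at
  `s = 0`; the mean value inequality on `[0, 1]` gives `J(1) = J(0)`).

Globally `C²` is what the application has (the harmonic part `p − p̃[χu]` of a smooth pressure
is smooth on `ℝ³` and harmonic on an annulus only); a function harmonic on an open set is
reduced to this case by a smooth cut-off.

## References

* D. Gilbarg, N. S. Trudinger, *Elliptic partial differential equations of second order*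
  (Springer, 2001 reprint), Thm 2.1 (mean value theorems, `B = B_R(y) ⊂⊂ Ω`).
  [`GilbargTrudinger2001`]
-/

noncomputable section

open MeasureTheory Set Filter Metric Topology InnerProductSpace Function
open scoped RealInnerProductSpace Laplacian

namespace Literature.Analysis.FluidPDE

variable {E : Type*} [NormedAddCommGroup E] [InnerProductSpace ℝ E] [FiniteDimensional ℝ E]

/-! ### The radial primitive with support control -/

omit [FiniteDimensional ℝ E] in
/-- **Radial fields are gradients, with support control.** A continuous radial `w : E → ℝ`
vanishing for `‖y‖ ≥ ρ` (`ρ > 0`) admits a `C¹` function `P` with `DP(y) = w(y) ⟨y, ·⟩` and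
`P(y) = 0` for `‖y‖ ≥ ρ`, namely `P(y) = ½ ∫₀^{‖y‖²} φ − ½ ∫₀^{ρ²} φ`, `φ(τ) = w(√τ e)` the radial
profile (as in `exists_radial_primitive`). [folklore] -/
theorem exists_radial_primitive_of_ball {w : E → ℝ} (hw : Continuous w) {ρ : ℝ} (hρ : 0 < ρ)
    (hw0 : ∀ y, ρ ≤ ‖y‖ → w y = 0) (hrad : ∀ x y, ‖x‖ = ‖y‖ → w x = w y) :
    ∃ P : E → ℝ, ContDiff ℝ 1 P ∧ (∀ y, ρ ≤ ‖y‖ → P y = 0) ∧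
      ∀ y, HasFDerivAt P (w y • (innerSL ℝ y : E →L[ℝ] ℝ)) y := by
  rcases subsingleton_or_nontrivial E with hE | hE
  · refine ⟨0, contDiff_const, fun _ _ => rfl, fun y => ?_⟩
    have hy : y = 0 := Subsingleton.elim y 0
    rw [hy, map_zero, smul_zero]
    exact hasFDerivAt_const (0 : ℝ) 0
  -- a unit vector and the radial profile
  obtain ⟨e, he⟩ : ∃ e : E, ‖e‖ = 1 := exists_norm_eq E zero_le_one
  set φ : ℝ → ℝ := fun τ => w (Real.sqrt τ • e) with hφ_def
  have hφ : Continuous φ := hw.comp (Real.continuous_sqrt.smul continuous_const)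
  have hφw : ∀ y : E, φ (‖y‖ ^ 2) = w y := fun y => by
    refine hrad _ _ ?_
    rw [norm_smul, he, mul_one, Real.norm_eq_abs, Real.sqrt_sq (norm_nonneg _),
      abs_of_nonneg (norm_nonneg _)]
  have hφ0 : ∀ τ, ρ ^ 2 ≤ τ → φ τ = 0 := fun τ hτ => by
    refine hw0 _ ?_
    rw [norm_smul, he, mul_one, Real.norm_eq_abs, abs_of_nonneg (Real.sqrt_nonneg _),
      ← Real.sqrt_sq hρ.le]
    exact Real.sqrt_le_sqrt hτ
  -- the primitive of the profile
  set Q : ℝ → ℝ := fun σ => ∫ τ in (0 : ℝ)..σ, φ τ with hQ_def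
  have hQ : ∀ σ, HasDerivAt Q (φ σ) σ := fun σ => (hφ.integral_hasStrictDerivAt 0 σ).hasDerivAt
  have hQρ : ∀ σ, ρ ^ 2 ≤ σ → Q σ = Q (ρ ^ 2) := fun σ hσ => by
    have hi : ∀ a b : ℝ, IntervalIntegrable φ volume a b := fun a b =>
      hφ.intervalIntegrable a b
    have h1 : Q σ - Q (ρ ^ 2) = ∫ τ in (ρ ^ 2)..σ, φ τ := by
      simp only [hQ_def]
      rw [intervalIntegral.integral_interval_sub_left (hi _ _) (hi _ _)]
    have h2 : ∫ τ in (ρ ^ 2)..σ, φ τ = 0 := by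
      rw [← intervalIntegral.integral_zero (a := ρ ^ 2) (b := σ) (μ := volume)]
      refine intervalIntegral.integral_congr fun τ hτ => ?_
      rw [uIcc_of_le hσ] at hτ
      exact hφ0 τ hτ.1
    linarith
  -- the primitive on `E`
  set P : E → ℝ := fun y => 2⁻¹ * (Q (‖y‖ ^ 2) - Q (ρ ^ 2)) with hP_def
  have hP : ∀ y, HasFDerivAt P (w y • (innerSL ℝ y : E →L[ℝ] ℝ)) y := fun y => by
    have h1 : HasFDerivAt (fun y : E => ‖y‖ ^ 2) (2 • (innerSL ℝ y : E →L[ℝ] ℝ)) y :=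
      (hasStrictFDerivAt_norm_sq y).hasFDerivAt
    have h2 : HasFDerivAt (fun y : E => Q (‖y‖ ^ 2))
        (φ (‖y‖ ^ 2) • (2 • (innerSL ℝ y : E →L[ℝ] ℝ))) y := by
      have := (hQ (‖y‖ ^ 2)).comp_hasFDerivAt y h1
      simpa only [Function.comp_def] using this
    have h3 := ((h2.sub_const (Q (ρ ^ 2))).const_mul 2⁻¹)
    refine h3.congr_fderiv ?_
    ext v
    simp only [_root_.FunLike.coe_smul, Pi.smul_apply, smul_eq_mul, hφw y]
    ring
  have hP0 : ∀ y, ρ ≤ ‖y‖ → P y = 0 := fun y hy => by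
    have : ρ ^ 2 ≤ ‖y‖ ^ 2 := by gcongr
    simp [hP_def, hQρ _ this]
  have hcont : Continuous fun y : E => w y • (innerSL ℝ y : E →L[ℝ] ℝ) :=
    hw.smul (innerSL ℝ (E := E)).continuous
  exact ⟨P, contDiff_one_iff_hasFDerivAt.2 ⟨_, hcont, hP⟩, hP0, hP⟩

/-! ### The core identity, local form -/

section Volume

variable [MeasurableSpace E] [BorelSpace E]

/-- **Core identity, local form.** For `η ∈ C²(E)` with `Δη = 0` on the ball `B(0, ρ)` and a
continuous radial weight `w` vanishing for `‖y‖ ≥ ρ`, `∫ w(y) Dη(y)[y] dy = 0`: with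
`w(y) y = ∇P(y)`, `P = 0` off `B(0, ρ)` (`exists_radial_primitive_of_ball`), this is
`∫ ⟨∇P, ∇η⟩ = -∫ P Δη = 0` by Green's first identity without boundary terms, the integrand
`P Δη` vanishing identically. [cite: GilbargTrudinger2001, Thm 2.1] -/
theorem integral_radial_mul_fderiv_apply_self_eq_zero_of_ball {η w : E → ℝ} (hη : ContDiff ℝ 2 η)
    {ρ : ℝ} (hρ : 0 < ρ) (hΔ : ∀ x ∈ ball (0 : E) ρ, (Δ η) x = 0) (hw : Continuous w)
    (hw0 : ∀ y, ρ ≤ ‖y‖ → w y = 0) (hrad : ∀ x y, ‖x‖ = ‖y‖ → w x = w y) :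
    ∫ y, w y * fderiv ℝ η y y = 0 := by
  obtain ⟨P, hP1, hP0, hP⟩ := exists_radial_primitive_of_ball hw hρ hw0 hrad
  have hPc : HasCompactSupport P := by
    refine HasCompactSupport.intro (isCompact_closedBall (0 : E) ρ) fun y hy => hP0 y ?_
    rw [mem_closedBall_zero_iff, not_le] at hy
    exact hy.le
  set b := stdOrthonormalBasis ℝ E
  have hη1 : ContDiff ℝ 1 η := hη.of_le one_le_two
  -- Green's first identity: `∫ Δη P + Σᵢ ∫ ∂ᵢη ∂ᵢP = 0`, and `Δη P ≡ 0`
  have green := FluidPDE.integral_inner_laplacian_add_eq_zero b hη hP1 (Or.inr hPc)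
  have h0 : ∫ x, ⟪(Δ η) x, P x⟫ = 0 := by
    rw [← integral_zero (α := E) (G := ℝ)]
    refine integral_congr_ae (Eventually.of_forall fun x => ?_)
    show ⟪(Δ η) x, P x⟫ = 0
    rcases lt_or_ge ‖x‖ ρ with hx | hx
    · rw [hΔ x (mem_ball_zero_iff.2 hx)]
      simp
    · rw [hP0 x hx]
      simp
  rw [h0, zero_add] at green
  -- the integrand is the sum over the basis
  have hfd : ∀ y, fderiv ℝ P y = w y • (innerSL ℝ y : E →L[ℝ] ℝ) := fun y => (hP y).fderiv
  have key : ∀ y, w y * fderiv ℝ η y y =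
      ∑ i, ⟪fderiv ℝ η y (b i), fderiv ℝ P y (b i)⟫ := fun y => by
    have hs : fderiv ℝ η y y = ∑ i, ⟪b i, y⟫ * fderiv ℝ η y (b i) := by
      have : fderiv ℝ η y y = fderiv ℝ η y (∑ i, ⟪b i, y⟫ • b i) := by rw [b.sum_repr' y]
      rw [this, map_sum]
      simp only [map_smul, smul_eq_mul]
    rw [hs, Finset.mul_sum]
    refine Finset.sum_congr rfl fun i _ => ?_
    rw [hfd y]
    simp only [_root_.FunLike.coe_smul, Pi.smul_apply, innerSL_apply_apply, smul_eq_mul]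
    simp only [RCLike.inner_apply, conj_trivial]
    rw [real_inner_comm]
    ring
  have hint : ∀ i, Integrable (fun y => ⟪fderiv ℝ η y (b i), fderiv ℝ P y (b i)⟫)
      (volume : Measure E) := fun i => by
    refine Continuous.integrable_of_hasCompactSupport ?_ ?_
    · exact (((hη1.continuous_fderiv one_ne_zero).clm_apply continuous_const)).inner
        ((hP1.continuous_fderiv one_ne_zero).clm_apply continuous_const)
    · exact (hPc.fderiv_apply (𝕜 := ℝ) (b i)).mono fun y hy => by
        contrapose! hy
        simp only [mem_support, not_not] at hy
        simp [hy]
  simp_rw [key]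
  rw [integral_finsetSum _ fun i _ => hint i]
  exact green

/-! ### The local weighted mean value property -/

/-- **Mean value property, local weighted radial form (Gilbarg–Trudinger, Thm 2.1).** Let
`η ∈ C²(E)` satisfy `Δη = 0` on the ball `B(x₀, ρ)`, and let `w` be a continuous radial weight
vanishing for `‖y‖ ≥ ρ`. Then `∫ w(x) η(x₀ + x) dx = (∫ w) · η(x₀)`. Proof: `J(s) = ∫ w(y)
η(x₀ + s y) dy` has derivative `∫ w(y) Dη(x₀ + s y)[y] dy`, which vanishes for `0 < s ≤ 1` by
rescaling to the local core identity (the rescaled weight `w(s⁻¹ ·)` vanishes for `‖x‖ ≥ sρ`,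
and `Δη(x₀ + ·) = 0` on `B(0, ρ)`) and for `s = 0` by oddness; hence `J(1) = J(0)` by the mean
value inequality on `[0, 1]`. [cite: GilbargTrudinger2001, Thm 2.1] -/
theorem integral_radial_mul_eq_of_laplacian_eq_zero {η w : E → ℝ} (hη : ContDiff ℝ 2 η)
    {x₀ : E} {ρ : ℝ} (hρ : 0 < ρ) (hΔ : ∀ x ∈ ball x₀ ρ, (Δ η) x = 0) (hw : Continuous w)
    (hw0 : ∀ y, ρ ≤ ‖y‖ → w y = 0) (hrad : ∀ x y, ‖x‖ = ‖y‖ → w x = w y) :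
    ∫ x, w x * η (x₀ + x) = (∫ x, w x) * η x₀ := by
  have hη1 : ContDiff ℝ 1 η := hη.of_le one_le_two
  have hηc : Continuous η := hη.continuous
  have hDηc : Continuous (fderiv ℝ η) := hη1.continuous_fderiv one_ne_zero
  have hηd : ∀ z, HasFDerivAt η (fderiv ℝ η z) z := fun z =>
    (hη1.differentiable one_ne_zero z).hasFDerivAt
  -- compact support of `w`
  have hc : HasCompactSupport w := by
    refine HasCompactSupport.intro (isCompact_closedBall (0 : E) ρ) fun y hy => hw0 y ?_
    rw [mem_closedBall_zero_iff, not_le] at hy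
    exact hy.le
  -- the one-parameter family and its derivative
  set J : ℝ → ℝ := fun s => ∫ y, w y * η (x₀ + s • y) with hJ_def
  set J' : ℝ → ℝ := fun s => ∫ y, w y * fderiv ℝ η (x₀ + s • y) y with hJ'_def
  -- Step 1: differentiation under the integral sign (every `s`)
  have hderiv : ∀ s, HasDerivAt J (J' s) s := by
    intro s
    obtain ⟨C, hC⟩ := (isCompact_closedBall x₀ ((|s| + 1) * ρ)).exists_bound_of_continuousOn
      hDηc.continuousOn
    have hC0 : 0 ≤ C := le_trans (norm_nonneg _) (hC x₀ (mem_closedBall_self (by positivity)))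
    have haff : ∀ s' : ℝ, Continuous fun y : E => x₀ + s' • y := fun s' =>
      continuous_const.add (continuous_id.const_smul s')
    have hFc : ∀ s', Continuous fun y => w y * η (x₀ + s' • y) := fun s' =>
      hw.mul (hηc.comp (haff s'))
    have hF_meas : ∀ s', AEStronglyMeasurable (fun y => w y * η (x₀ + s' • y))
        (volume : Measure E) := fun s' => (hFc s').aestronglyMeasurable
    have hF_int : Integrable (fun y => w y * η (x₀ + s • y)) (volume : Measure E) :=
      (hFc s).integrable_of_hasCompactSupport hc.mul_right
    have hF'c : Continuous fun y => w y * fderiv ℝ η (x₀ + s • y) y :=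
      hw.mul ((hDηc.comp (haff s)).clm_apply continuous_id)
    have hF'_meas : AEStronglyMeasurable (fun y => w y * fderiv ℝ η (x₀ + s • y) y)
        (volume : Measure E) := hF'c.aestronglyMeasurable
    have h_bound : ∀ᵐ y ∂(volume : Measure E), ∀ s' ∈ ball s 1,
        ‖w y * fderiv ℝ η (x₀ + s' • y) y‖ ≤ C * ρ * |w y| := by
      refine Eventually.of_forall fun y s' hs' => ?_
      rcases le_or_gt ρ ‖y‖ with hy | hy
      · simp [hw0 y hy]
      · have hmem : x₀ + s' • y ∈ closedBall x₀ ((|s| + 1) * ρ) := by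
          rw [mem_closedBall, dist_eq_norm, add_sub_cancel_left, norm_smul, Real.norm_eq_abs]
          have hs'1 : |s'| ≤ |s| + 1 := by
            rw [mem_ball, Real.dist_eq] at hs'
            have := abs_sub_abs_le_abs_sub s' s
            linarith
          exact mul_le_mul hs'1 hy.le (norm_nonneg _) (by positivity)
        rw [norm_mul, Real.norm_eq_abs]
        calc |w y| * ‖fderiv ℝ η (x₀ + s' • y) y‖
            ≤ |w y| * (C * ρ) := by
              refine mul_le_mul_of_nonneg_left ?_ (abs_nonneg _)
              calc ‖fderiv ℝ η (x₀ + s' • y) y‖ ≤ ‖fderiv ℝ η (x₀ + s' • y)‖ * ‖y‖ :=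
                    ContinuousLinearMap.le_opNorm _ _
                _ ≤ C * ρ := mul_le_mul (hC _ hmem) hy.le (norm_nonneg _) hC0
          _ = C * ρ * |w y| := by ring
    have h_diff : ∀ᵐ y ∂(volume : Measure E), ∀ s' ∈ ball s 1,
        HasDerivAt (fun r => w y * η (x₀ + r • y)) (w y * fderiv ℝ η (x₀ + s' • y) y) s' := by
      refine Eventually.of_forall fun y s' _ => ?_
      have h1 : HasDerivAt (fun r : ℝ => x₀ + r • y) y s' := by
        simpa using ((hasDerivAt_id s').smul_const y).const_add x₀
      have h2 := (hηd (x₀ + s' • y)).comp_hasDerivAt s' h1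
      exact h2.const_mul (w y)
    exact (hasDerivAt_integral_of_dominated_loc_of_deriv_le (ball_mem_nhds s one_pos)
      (Eventually.of_forall hF_meas) hF_int hF'_meas h_bound
      ((hw.abs.integrable_of_hasCompactSupport hc.abs).const_mul (C * ρ)) h_diff).2
  -- Step 2: the derivative vanishes on `[0, 1]`
  have hJ'0 : ∀ s ∈ Icc (0 : ℝ) 1, J' s = 0 := by
    intro s hs
    rcases eq_or_ne s 0 with rfl | hs0
    · -- oddness at `s = 0`
      have hodd : ∀ y : E, w ((-1 : ℝ) • y) * fderiv ℝ η (x₀ + (0 : ℝ) • ((-1 : ℝ) • y))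
          ((-1 : ℝ) • y) = -(w y * fderiv ℝ η (x₀ + (0 : ℝ) • y) y) := fun y => by
        rw [hrad ((-1 : ℝ) • y) y (by simp)]
        simp
      have h1 := Measure.integral_comp_smul (volume : Measure E)
        (fun y => w y * fderiv ℝ η (x₀ + (0 : ℝ) • y) y) (-1)
      simp only [hodd, integral_neg, abs_inv, abs_pow, abs_neg, abs_one,
        one_pow, inv_one, one_smul] at h1
      show (∫ y, w y * fderiv ℝ η (x₀ + (0 : ℝ) • y) y) = 0
      linarith
    · -- rescaling to the local core identity for `0 < s ≤ 1`
      have hs_pos : 0 < s := lt_of_le_of_ne hs.1 (Ne.symm hs0)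
      set wt : E → ℝ := fun x => w (s⁻¹ • x) with hwt
      set ηt : E → ℝ := fun x => η (x₀ + x) with hηt
      have hwt_c : Continuous wt := hw.comp (continuous_const.smul continuous_id)
      have hwt_0 : ∀ y, ρ ≤ ‖y‖ → wt y = 0 := fun y hy => by
        refine hw0 _ ?_
        rw [norm_smul, norm_inv, Real.norm_eq_abs, abs_of_pos hs_pos]
        calc ρ = s⁻¹ * (s * ρ) := by field_simp
          _ ≤ s⁻¹ * ‖y‖ := by
              refine mul_le_mul_of_nonneg_left ?_ (inv_nonneg.2 hs_pos.le)
              calc s * ρ ≤ 1 * ρ := mul_le_mul_of_nonneg_right hs.2 hρ.le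
                _ = ρ := one_mul ρ
                _ ≤ ‖y‖ := hy
      have hwt_r : ∀ x y, ‖x‖ = ‖y‖ → wt x = wt y := fun x y hxy =>
        hrad _ _ (by simp [norm_smul, hxy])
      have hηt2 : ContDiff ℝ 2 ηt := hη.comp (contDiff_const.add contDiff_id)
      have hηtΔ : ∀ x ∈ ball (0 : E) ρ, (Δ ηt) x = 0 := fun x hx => by
        rw [hηt, laplacian_comp_const_add]
        refine hΔ _ ?_
        rwa [mem_ball, dist_eq_norm, add_sub_cancel_left, ← mem_ball_zero_iff]
      have core := integral_radial_mul_fderiv_apply_self_eq_zero_of_ball hηt2 hρ hηtΔ hwt_c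
        hwt_0 hwt_r
      have hfd : ∀ x, fderiv ℝ ηt x = fderiv ℝ η (x₀ + x) := fun x => fderiv_comp_add_left x₀
      simp_rw [hfd] at core
      -- substitute `y = s⁻¹ x`
      set f : E → ℝ := fun x => wt x * fderiv ℝ η (x₀ + x) (s⁻¹ • x) with hf
      have h1 : (fun y => w y * fderiv ℝ η (x₀ + s • y) y) = fun y => f (s • y) := by
        funext y
        simp only [hf, hwt, inv_smul_smul₀ hs0]
      have h2 : ∫ x, f x = s⁻¹ * ∫ x, wt x * fderiv ℝ η (x₀ + x) x := by
        rw [← integral_const_mul]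
        refine integral_congr_ae (Eventually.of_forall fun x => ?_)
        simp only [hf, map_smul, smul_eq_mul]
        ring
      show (∫ y, w y * fderiv ℝ η (x₀ + s • y) y) = 0
      rw [h1, Measure.integral_comp_smul volume f s, h2, core, mul_zero, smul_zero]
  -- Step 3: `J 1 = J 0` by the mean value inequality on `[0, 1]`
  have hconst : J 1 = J 0 := by
    have h := norm_image_sub_le_of_norm_deriv_le_segment_01' (f := J) (f' := J') (C := 0)
      (fun s hs => (hderiv s).hasDerivWithinAt) (fun s hs => by
        rw [hJ'0 s (Ico_subset_Icc_self hs), norm_zero])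
    have h' : ‖J 1 - J 0‖ = 0 := le_antisymm h (norm_nonneg _)
    rw [norm_eq_zero, sub_eq_zero] at h'
    exact h'
  have hJ1 : J 1 = ∫ x, w x * η (x₀ + x) := by simp [hJ_def]
  have hJ0 : J 0 = (∫ x, w x) * η x₀ := by
    simp only [hJ_def, zero_smul, add_zero]
    exact integral_mul_const (η x₀) w
  rw [← hJ1, hconst, hJ0]

end Volume

end Literature.Analysis.FluidPDE

end
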